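import Summits.BirchSwinnertonDyer.BirchSwinnertonDyer.Theorems.GoldfeldAllTwistsTwoConverseTwinAdditiveTwoSplitFiveTwistSelmer
import HarnessLib

set_option linter.dupNamespace false -- namespace `…BirchSwinnertonDyer.BirchSwinnertonDyer…` is the cell's (D-0017 nested layout)
set_option autoImplicit false

/-!
# Twin″ (item 19140), LINE B⁗ T3-D part 1: the LOCAL LEMMAS of the `2`-isogeny descent for the twists `49a1^{(−2qp)}` on the
# family-C conditions (`q ≡ 3 (4)`, `(q/7) = −1`; `p ≡ 5 (8)`, `(−7/p) = 1`; `(p/q) = −1`; `q ≡ 7 (8)` or `−7` a fourth power mod `p`)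

Cell `bsd-goldfeld`, seat `bsd-goldfeld-s1p-c3x` (gen 10); planner ORDER (cccxvii) «LINE B⁗ — TRANCHE 3», object T3-D (= N3), first file.
`--supports stmt-BirchSwinnertonDyer-19140` as a HELPER. FACT-FREE: no print binder, no definition, no `sorry`.

For `E : y² = x³ − 42qp·x² + 448q²p²·x` (the templates' model of `49a1^{(−2qp)}`), `S = S(−42qp, 448q²p²)`. Memo
`ROUTE-S1PLUS/b4-c3xg10/T3D-DESCENT-KILLTABLE.md` (brute-force numerics: `S = {1, 7}`, `S′ = {1, −7, −2q, 14q}` on all three sub-cells;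
the corner `q ≡ 3 (8) ∧ ¬β` has `S = {1,7,2p,14p}`, so the cell condition is sharp).
* §1 `not_isSoluble_padic_of_prime_dvd_coeffs_of_roots` — a prime dividing all three coefficients, the reduced quadratic having NO SQUARE
  root mod `p` (the split-prime counterpart of part I's `not_isSoluble_padic_of_prime_dvd_coeffs`, whose hypothesis is an irreducible quadratic).
* §2 the residue facts of the family and the type-β square roots: with `x⁴ = −7`, `r = (21 + x²)/2 = (x(x² − 3)/2)²`.
Parts 2–3 (next files): `#S ≤ 2` (`S ⊆ {1, 7}`: negatives at `ℝ`; the `q`-classes at `q`; `2, 14` at `p`; `p, 7p` at `q`; `2p, 14p` at `q` when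
`q ≡ 7 (8)` and at `p` under β by §1 — the roots `q·r`, `q·r̄`, … are `q`·squares, non-residues), `#S′ ≤ 4` (`S′ ⊆ {1, −7, −2q, 14q}`), and
the descent consequences (`rank ≤ 1`; `Ш[2] = 0` in rank one) exactly as the template `…TwinAdditiveTwoInertSevenTwistDescent`.
HONEST FRAMING: no `BSD(W,2)` is proved; BSD is not proved by any of this.

References: [SilvermanAEC2009] X.4.9–X.4.10; [Zywina2025] Lemma 3.1.
-/

noncomputable section

open scoped Classical

open WeierstrassCurve Literature.NumberTheory.EllipticCurves
open Literature.NumberTheory.EllipticCurves.Zywina2025 (exists_padicInt_of_isSoluble isSquare_zmod_of_isSoluble_padic)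

namespace Summit.BirchSwinnertonDyer.BirchSwinnertonDyer.Theorems.GoldfeldGoodTwists

/-! ## §1 A prime dividing all three coefficients, the reduced quadratic without square roots -/

/-- In `ℤ_p`: `x mod p = 0 ↔ p ∣ x`. [folklore] -/
private theorem toZMod_eq_zero_iff_dvd₂ {p : ℕ} [Fact p.Prime] (x : ℤ_[p]) :
    PadicInt.toZMod x = 0 ↔ (p : ℤ_[p]) ∣ x := by
  rw [← RingHom.mem_ker, PadicInt.ker_toZMod, PadicInt.maximalIdeal_eq_span_p, Ideal.mem_span_singleton]

/-- Core: `s² = p·(f + c t² + f′ t⁴)` in `ℤ_p` forces `p ∣ f + c t² + f′ t⁴`, i.e. `T := (t mod p)²` is a SQUARE root of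
`f′ X² + c X + f` modulo `p`. [folklore] -/
private theorem sq_root_of_sq_eq_prime_mul_quartic {p : ℕ} [Fact p.Prime] {f c f' : ℤ} {t s : ℤ_[p]}
    (h : s ^ 2 = (p : ℤ_[p]) * ((f : ℤ_[p]) + (c : ℤ_[p]) * t ^ 2 + (f' : ℤ_[p]) * t ^ 4)) :
    (f' : ZMod p) * (PadicInt.toZMod t ^ 2) ^ 2 + c * (PadicInt.toZMod t ^ 2) + f = 0 := by
  have hpp : Prime (p : ℤ_[p]) := PadicInt.prime_p
  have hps : (p : ℤ_[p]) ∣ s := hpp.dvd_of_dvd_pow (n := 2) ⟨_, h⟩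
  obtain ⟨s₁, rfl⟩ := hps
  have hg : (p : ℤ_[p]) ∣ ((f : ℤ_[p]) + (c : ℤ_[p]) * t ^ 2 + (f' : ℤ_[p]) * t ^ 4) := by
    refine ⟨s₁ ^ 2, mul_left_cancel₀ hpp.ne_zero ?_⟩
    rw [← h]
    ring
  have hg0 : PadicInt.toZMod ((f : ℤ_[p]) + (c : ℤ_[p]) * t ^ 2 + (f' : ℤ_[p]) * t ^ 4) = 0 := (toZMod_eq_zero_iff_dvd₂ _).mpr hg
  simp only [map_add, map_mul, map_pow, map_intCast] at hg0
  linear_combination hg0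

/-- **Local lemma (split-prime counterpart of part I's).** If `p` divides all three coefficients — `a = pc`, `d = pe`, `d′ = pe′` —
`p ∤ e′`, and NO root of `e′X² + cX + e` modulo `p` is a square, then `w² = d u⁴ + a u²z² + d′ z⁴` has no non-trivial `ℚ_p`-point:
in the chart `z = 1` the square `T = t²` would be such a root; in the chart `u = 1`, `T = t²` is a root of `eX² + cX + e′`, non-zero
(`p ∤ e′`), and `T⁻¹` is a square root of `e′X² + cX + e`. [cite: SilvermanAEC2009, Prop. X.4.9 and Example X.4.10] -/
theorem not_isSoluble_padic_of_prime_dvd_coeffs_of_roots {p : ℕ} [Fact p.Prime] {a d d' c e e' : ℤ}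
    (ha : a = p * c) (hd : d = p * e) (hd' : d' = p * e') (he' : ((e' : ℤ) : ZMod p) ≠ 0)
    (hroots : ∀ T : ZMod p, (e' : ZMod p) * T ^ 2 + c * T + e = 0 → ¬ IsSquare T) :
    ¬ ((twoIsogenyQuartic a d d').map (Int.castRingHom ℚ_[p])).IsSoluble := by
  intro h
  obtain ⟨f, f', hff, t, s, hs⟩ := exists_padicInt_of_isSoluble h
  rcases hff with ⟨rfl, rfl⟩ | ⟨rfl, rfl⟩
  · have hT := sq_root_of_sq_eq_prime_mul_quartic (f := e) (c := c) (f' := e') (t := t) (s := s)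
      (by rw [hs, ha, hd, hd']; push_cast; ring)
    exact hroots _ hT ⟨PadicInt.toZMod t, by ring⟩
  · have hT := sq_root_of_sq_eq_prime_mul_quartic (f := e') (c := c) (f' := e) (t := t) (s := s)
      (by rw [hs, ha, hd, hd']; push_cast; ring)
    -- `T = (t mod p)²` is a non-zero root of `eX² + cX + e′`; its inverse is a square root of `e′X² + cX + e`
    set T : ZMod p := PadicInt.toZMod t ^ 2 with hTdef
    have hT0 : T ≠ 0 := by
      intro h0
      rw [h0] at hT
      simp only [ne_eq, zero_pow, OfNat.ofNat_ne_zero, not_false_eq_true, mul_zero, add_zero, zero_add] at hT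
      exact he' hT
    have hinv : (e' : ZMod p) * T⁻¹ ^ 2 + c * T⁻¹ + e = 0 := by
      have e1 : (e' : ZMod p) * T⁻¹ ^ 2 + c * T⁻¹ + e = ((e : ZMod p) * T ^ 2 + c * T + e') * T⁻¹ ^ 2 := by
        field_simp
        ring
      rw [e1, hT, zero_mul]
    exact hroots _ hinv ⟨(PadicInt.toZMod t)⁻¹, by rw [hTdef, ← inv_pow, pow_two]⟩

/-- Roots of a quadratic over a field of characteristic `≠ 2`: `e′T² + cT + e = 0`, `e′ ≠ 0`, `δ² = c² − 4e′e` ⇒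
`T = (−c + δ)/(2e′)` or `T = (−c − δ)/(2e′)`. [folklore] -/
theorem quadratic_root_cases {F : Type*} [Field F] [NeZero (2 : F)] {e' c e δ T : F} (he' : e' ≠ 0)
    (hδ : δ ^ 2 = c ^ 2 - 4 * e' * e) (hT : e' * T ^ 2 + c * T + e = 0) :
    T = (-c + δ) / (2 * e') ∨ T = (-c - δ) / (2 * e') := by
  have h2 : (2 : F) ≠ 0 := NeZero.ne 2
  have hsq : (2 * e' * T + c) ^ 2 = δ ^ 2 := by rw [hδ]; linear_combination (4 * e') * hT
  rcases sq_eq_sq_iff_eq_or_eq_neg.mp hsq with h | h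
  · left; field_simp; linear_combination h
  · right; field_simp; linear_combination h

/-! ## §2 The family's residue facts; the type-β square roots -/

section Residues
variable {q p : ℕ} [Fact q.Prime] [Fact p.Prime]

/-- `q ≡ 3 (4)`, `(q/7) = −1` ⇒ `(7/q) = +1` and `(−7/q) = −1`. [folklore] -/
theorem legendreSym_seven_and_neg_seven_of_three_mod_four (hq4 : q % 4 = 3) (hq7 : jacobiSym q 7 = -1) :
    legendreSym q 7 = 1 ∧ legendreSym q (-7) = -1 := by
  haveI : Fact (Nat.Prime 7) := ⟨by norm_num⟩
  have hq2 : q ≠ 2 := by rintro rfl; norm_num at hq4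
  have hq7' : q ≠ 7 := by
    rintro rfl
    rw [jacobiSym.mod_left] at hq7; norm_num at hq7
  have h7q : legendreSym 7 q = -1 := by rw [jacobiSym.legendreSym.to_jacobiSym]; exact_mod_cast hq7
  have hrec := legendreSym.quadratic_reciprocity_three_mod_four (p := q) (q := 7) (by omega) (by norm_num)
  have h7 : legendreSym q 7 = 1 := by rw [h7q] at hrec; push_cast at hrec; linarith
  refine ⟨h7, ?_⟩
  have hm1 : legendreSym q (-1) = -1 := by rw [legendreSym.at_neg_one hq2, ZMod.χ₄_nat_three_mod_four (by omega)]
  rw [show (-7 : ℤ) = -1 * 7 by norm_num, legendreSym.mul, hm1, h7]; norm_num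

/-- `p ≡ 5 (8)`, `(−7/p) = 1` ⇒ `(2/p) = −1`, `(7/p) = +1`, `(−1/p) = +1`. [folklore] -/
theorem legendreSym_two_seven_neg_one_of_five_mod_eight (hp8 : p % 8 = 5) (hp7 : legendreSym p (-7) = 1) :
    legendreSym p 2 = -1 ∧ legendreSym p 7 = 1 ∧ legendreSym p (-1) = 1 := by
  have hp2 : p ≠ 2 := by rintro rfl; norm_num at hp8
  have hp2' : p % 2 = 1 := by omega
  have h2 : legendreSym p 2 = -1 := by rw [legendreSym.at_two hp2, ZMod.χ₈_nat_eq_if_mod_eight]; simp [hp8, hp2']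
  have hm1 : legendreSym p (-1) = 1 := by rw [legendreSym.at_neg_one hp2, ZMod.χ₄_nat_one_mod_four (by omega)]
  have h7 : legendreSym p 7 = 1 := by
    have hmul : legendreSym p (-7) = legendreSym p (-1) * legendreSym p 7 := by rw [← legendreSym.mul]; norm_num
    rw [hmul, hm1, one_mul] at hp7; exact hp7
  exact ⟨h2, h7, hm1⟩

/-- `(p/q) = −1`, `p ≡ 1 (4)` ⇒ `(q/p) = −1`. [folklore] -/
theorem legendreSym_swap_of_one_mod_four (hp4 : p % 4 = 1) (hqp : q ≠ p) (hq2 : q ≠ 2) (hpq : jacobiSym p q = -1) :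
    legendreSym p q = -1 ∧ legendreSym q p = -1 := by
  have hqp' : legendreSym q p = -1 := by rw [jacobiSym.legendreSym.to_jacobiSym]; exact_mod_cast hpq
  have hp2 : p ≠ 2 := by rintro rfl; norm_num at hp4
  refine ⟨?_, hqp'⟩
  rw [← legendreSym.quadratic_reciprocity_one_mod_four hp4 hq2, hqp']

/-- **Type β square root.** In a field of characteristic `≠ 2`, `x⁴ = −7` ⇒ `(x(x² − 3)/2)² = (21 + x²)/2`. [folklore] -/
theorem sq_half_x_cube_sub_of_pow_four {F : Type*} [Field F] [NeZero (2 : F)] {x : F} (hx : x ^ 4 = -7) :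
    (x * (x ^ 2 - 3) / 2) ^ 2 = (21 + x ^ 2) / 2 := by
  have h2 : (2 : F) ≠ 0 := NeZero.ne 2
  rw [div_pow, div_eq_div_iff (pow_ne_zero 2 h2) h2]
  linear_combination (2 * x ^ 2 - 12) * hx

/-- The two roots `r, r̄` of `X² − 21X + 112`: `r = (21 + s)/2`, `r̄ = (21 − s)/2` with `s² = −7`; `r·r̄ = 112`, `r + r̄ = 21`. Under β
(`x⁴ = −7`, `p ≡ 1 (4)`) BOTH are squares: `r = (x(x²−3)/2)²` and `r̄` likewise with `y = jx`, `j² = −1`. [folklore] -/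
theorem isSquare_roots_of_pow_four_eq_neg_seven {F : Type*} [Field F] [NeZero (2 : F)] {x j : F} (hx : x ^ 4 = -7) (hj : j ^ 2 = -1) :
    IsSquare ((21 + x ^ 2) / 2) ∧ IsSquare ((21 - x ^ 2) / 2) := by
  refine ⟨⟨x * (x ^ 2 - 3) / 2, by rw [← pow_two, sq_half_x_cube_sub_of_pow_four hx]⟩,
    ⟨(j * x) * ((j * x) ^ 2 - 3) / 2, ?_⟩⟩
  have hy : (j * x) ^ 4 = -7 := by rw [mul_pow, show (4 : ℕ) = 2 * 2 from rfl, pow_mul, hj]; norm_num; exact hx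
  rw [← pow_two, sq_half_x_cube_sub_of_pow_four hy, mul_pow, hj]; ring


/-- **The type-β obstruction at `p` (the root test of §1 for the classes `2p`, `14p` of `S`).** In a field with `2, 448 ≠ 0`, let
`x⁴ = −7`, `j² = −1`, `q ≠ 0` a NON-square, and `e′T² + cT + e = 0` with `c = −42q`, `e′e = 448q²`, `e′ ≠ 0`, `2qe′` a non-square
(for `(e′, e) = (224q², 2)`: `2qe′ = 7q·(8q)²`; for `(32q², 14)`: `q·(8q)²`). Then `T` is NOT a square: the roots are `T = 2q·r²/e′` with
`r² = (21 ± x²)/2` (§2), so `T = w²` would make `2qe′ = (e′w/r)²`. [cite: SilvermanAEC2009, Example X.4.10] -/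
theorem not_isSquare_root_typeBeta {F : Type*} [Field F] [NeZero (2 : F)] {x j qF e' e c T : F} (hx : x ^ 4 = -7) (hj : j ^ 2 = -1)
    (h448 : (448 : F) ≠ 0) (he' : e' ≠ 0) (hc : c = -42 * qF) (hee : e' * e = 448 * qF ^ 2)
    (hns : ¬ IsSquare (2 * qF * e')) (hT : e' * T ^ 2 + c * T + e = 0) : ¬ IsSquare T := by
  have h2 : (2 : F) ≠ 0 := NeZero.ne 2
  obtain ⟨⟨r₁, hr₁⟩, ⟨r₂, hr₂⟩⟩ := isSquare_roots_of_pow_four_eq_neg_seven hx hj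
  have h1 : 21 + x ^ 2 = 2 * r₁ * r₁ := by field_simp at hr₁; linear_combination hr₁
  have h1' : 21 - x ^ 2 = 2 * r₂ * r₂ := by field_simp at hr₂; linear_combination hr₂
  have hr₁0 : r₁ ≠ 0 := by
    rintro rfl
    apply h448
    linear_combination (21 - x ^ 2) * h1 + hx
  have hr₂0 : r₂ ≠ 0 := by
    rintro rfl
    apply h448
    linear_combination (21 + x ^ 2) * h1' + hx
  have hδ : (2 * qF * x ^ 2) ^ 2 = c ^ 2 - 4 * e' * e := by
    rw [hc]; linear_combination (4 * qF ^ 2) * hx + 4 * hee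
  rintro ⟨w, hw⟩
  apply hns
  rcases quadratic_root_cases he' hδ hT with h | h
  · -- `T = (42q + 2qx²)/(2e′) = 2q·r₁²/e′`
    have hTe : T * e' = 2 * qF * r₁ * r₁ := by
      rw [h, hc]; field_simp; linear_combination (2 * qF) * h1
    refine ⟨e' * w / r₁, ?_⟩
    field_simp
    linear_combination (-1 : F) * hTe + e' * hw
  · -- `T = (42q − 2qx²)/(2e′) = 2q·r₂²/e′`
    have hTe : T * e' = 2 * qF * r₂ * r₂ := by
      rw [h, hc]; field_simp; linear_combination (2 * qF) * h1'
    refine ⟨e' * w / r₂, ?_⟩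
    field_simp
    linear_combination (-1 : F) * hTe + e' * hw

end Residues



end Summit.BirchSwinnertonDyer.BirchSwinnertonDyer.Theorems.GoldfeldGoodTwists

end
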